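import Summits.MatrixMultiplication.OmegaCensus.DominoZpZpStructFiveCore
import Summits.MatrixMultiplication.OmegaCensus.DominoZpZpScaled
import HarnessLib

/-!
# Structural cover argument for part size `5`: the finite PAIR CHECK and its soundness

ω-census `pub-omega`, family (b3), seat pub-omega-group gen 23.  Framing: lottery ticket; floor = certified bounds/negative
ranges.  VALUE: reduces the pair property `h3` of `DominoZpZpStructFiveCore.exists_goodP` (a statement about ALL pairs of value
quintuples with excluded keys) to a Bool program `checkH3 p EC YS R` over the scaling REPRESENTATIVES `R` of the excluded list `E`
(`EC` = the codes `polyBE 6` of `E`, `YS = allArr23 p R` the precomputed `y`-arrangements), decided per prime in the cells files (`6·6·36 = 1296` configurations for `p = 19`);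
NOT progress on ω.

`checkH3` enumerates, for `k₁ ∈ R`, the arrangements `[a,a,b,c,e]` with count vector `k₁` (`arrangements01`) and, for `k₂ ∈ R`,
`[b',c',a',a',e']` with count vector `k₂` (`arrangements23`; values drawn from the supports), and requires `pairGood`: one of the ten
index pairs `{i,j}` separates the two points `(xᵢ,yᵢ) ≠ (xⱼ,yⱼ)` and the quintuple `mₖ = (yᵢ−yⱼ)xₖ + (xⱼ−xᵢ)yₖ (mod p)` (the
line values of the direction collapsing `i, j`, `mVal`) has a count vector whose code is NOT among `EC`.
**Soundness (`h3_of_checkH3`).**  Given `x` (`x₀ = x₁`) and `y` (`y₂ = y₃`) with keys in `E`, scale each by a unit into `R`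
(`hR`; keys of unit multiples are `scaleVec`s, `key5_smul`), locate the arrangements `vals x'`, `vals y'` in the enumerations (every guard is
passed because each value occurs, `one_le_getD_key5`), get the good pair, identify `mVal` with the values of `(κμ)·m`
(`natCast_mVal`), and unscale by the closure of `E` (`key5_smul_mem`).
-/

namespace Summit.MatrixMultiplication.OmegaCensus

open Finset

namespace ZpZpDomino

/-! ## The program -/

section Program

/-- The ten index pairs `i < j` of `Fin 5`. [folklore] -/
def pairs10 : List (ℕ × ℕ) := [(0,1), (0,2), (0,3), (0,4), (1,2), (1,3), (1,4), (2,3), (2,4), (3,4)]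

/-- The pairs are valid distinct indices. [folklore] -/
theorem pairs10_spec : ∀ ij ∈ pairs10, ij.1 < 5 ∧ ij.2 < 5 ∧ ij.1 ≠ ij.2 := by decide

/-- Value `k` of the direction collapsing `i, j` of the configuration `(xs, ys)`, on naturals:
`((yᵢ + (p − yⱼ))·xₖ + (xⱼ + (p − xᵢ))·yₖ) mod p`. [folklore] -/
def mVal (p : ℕ) (xs ys : List ℕ) (i j k : ℕ) : ℕ :=
  ((ys.getD i 0 + (p - ys.getD j 0)) * xs.getD k 0 + (xs.getD j 0 + (p - xs.getD i 0)) * ys.getD k 0) % p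

/-- Some index pair separates the points and collapses to a quintuple whose count-vector code is not in `EC`. [folklore] -/
def pairGood (p : ℕ) (EC : List ℕ) (xs ys : List ℕ) : Bool :=
  pairs10.any fun ij =>
    (!(xs.getD ij.1 0 == xs.getD ij.2 0) || !(ys.getD ij.1 0 == ys.getD ij.2 0)) &&
      !(EC.contains (hornerS 6 (cv5 p (mVal p xs ys ij.1 ij.2 0) (mVal p xs ys ij.1 ij.2 1) (mVal p xs ys ij.1 ij.2 2)
        (mVal p xs ys ij.1 ij.2 3) (mVal p xs ys ij.1 ij.2 4)) 0))

/-- The arrangements `[a,a,b,c,e]` (values in the support of `k`, count vector `k`). [folklore] -/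
def arrangements01 (p : ℕ) (k : List ℕ) : List (List ℕ) :=
  (List.range p).flatMap fun a => if k.getD a 0 == 0 then [] else
    (List.range p).flatMap fun b => if k.getD b 0 == 0 then [] else
      (List.range p).flatMap fun c => if k.getD c 0 == 0 then [] else
        (List.range p).flatMap fun e => if k.getD e 0 == 0 then [] else
          if cv5 p a a b c e == k then [[a, a, b, c, e]] else []

/-- The arrangements `[b',c',a',a',e']` (values in the support of `k`, count vector `k`). [folklore] -/
def arrangements23 (p : ℕ) (k : List ℕ) : List (List ℕ) :=
  (List.range p).flatMap fun a => if k.getD a 0 == 0 then [] else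
    (List.range p).flatMap fun b => if k.getD b 0 == 0 then [] else
      (List.range p).flatMap fun c => if k.getD c 0 == 0 then [] else
        (List.range p).flatMap fun e => if k.getD e 0 == 0 then [] else
          if cv5 p b c a a e == k then [[b, c, a, a, e]] else []

/-- All `y`-arrangements of a list of keys. [folklore] -/
def allArr23 (p : ℕ) (R : List (List ℕ)) : List (List ℕ) := R.flatMap (arrangements23 p)

/-- The pair check for ONE key `k₁`: every `x`-arrangement of `k₁` is `pairGood` against every `y`-arrangement in `YS`.
[folklore] -/
def checkH3k (p : ℕ) (EC : List ℕ) (YS : List (List ℕ)) (k₁ : List ℕ) : Bool :=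
  (arrangements01 p k₁).all fun xs => YS.all fun ys => pairGood p EC xs ys

/-- **The pair check** over representatives `R` (with `YS = allArr23 p R` precomputed by the caller). [folklore] -/
def checkH3 (p : ℕ) (EC : List ℕ) (YS : List (List ℕ)) (R : List (List ℕ)) : Bool :=
  R.all fun k₁ => checkH3k p EC YS k₁

end Program

/-! ## Soundness -/

section Sound

variable {p : ℕ} [Fact p.Prime]

/-- The list of values of a quintuple. [folklore] -/
def vals (a : Fin 5 → ZMod p) : List ℕ := [(a 0).val, (a 1).val, (a 2).val, (a 3).val, (a 4).val]

omit [Fact p.Prime] in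
/-- Entries of `vals`. [folklore] -/
theorem getD_vals (a : Fin 5 → ZMod p) (k : Fin 5) : (vals a).getD k.val 0 = (a k).val := by
  fin_cases k <;> rfl

/-- **`mVal` computes the line values of the collapsing direction**: cast to `ZMod p` it is
`(yᵢ − yⱼ)·xₖ − (xᵢ − xⱼ)·yₖ`. [folklore] -/
theorem natCast_mVal (x y : Fin 5 → ZMod p) (i j k : Fin 5) :
    ((mVal p (vals x) (vals y) i.val j.val k.val : ℕ) : ZMod p) = (y i - y j) * x k - (x i - x j) * y k := by
  unfold mVal
  rw [getD_vals, getD_vals, getD_vals, getD_vals, getD_vals, getD_vals, ZMod.natCast_mod]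
  push_cast
  rw [Nat.cast_sub (ZMod.val_le _), Nat.cast_sub (ZMod.val_le _)]
  simp only [ZMod.natCast_val, ZMod.cast_id', id_eq, ZMod.natCast_self]
  ring

omit [Fact p.Prime] in
/-- `mVal` is a residue. [folklore] -/
theorem mVal_lt (hp : 0 < p) (xs ys : List ℕ) (i j k : ℕ) : mVal p xs ys i j k < p := Nat.mod_lt _ hp

/-- The value of the collapsing quintuple equals `mVal`. [folklore] -/
theorem val_m_eq_mVal (x y : Fin 5 → ZMod p) (i j k : Fin 5) :
    ((y i - y j) * x k - (x i - x j) * y k).val = mVal p (vals x) (vals y) i.val j.val k.val := by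
  rw [← natCast_mVal, ZMod.val_natCast, Nat.mod_eq_of_lt (mVal_lt (Fact.out : p.Prime).pos _ _ _ _ _)]

/-- **Soundness of `pairGood`** for the value lists of two quintuples `x, y`: a pair `i ≠ j` whose collapsing quintuple has a
key outside `E`. [folklore] -/
theorem exists_pair_of_pairGood {E : List (List ℕ)} (x y : Fin 5 → ZMod p)
    (h : pairGood p (E.map (polyBE 6)) (vals x) (vals y) = true) :
    ∃ i j : Fin 5, i ≠ j ∧ key5 (fun k => (y i - y j) * x k - (x i - x j) * y k) ∉ E := by
  rw [pairGood, List.any_eq_true] at h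
  obtain ⟨ij, hij, hgood⟩ := h
  obtain ⟨hi, hj, hne⟩ := pairs10_spec ij hij
  rw [Bool.and_eq_true] at hgood
  obtain ⟨-, hnot⟩ := hgood
  refine ⟨⟨ij.1, hi⟩, ⟨ij.2, hj⟩, fun e => hne (congrArg Fin.val e), fun hmem => ?_⟩
  rw [Bool.not_eq_true', hornerS_zero] at hnot
  have hcode : polyBE 6 (key5 fun k => (y ⟨ij.1, hi⟩ - y ⟨ij.2, hj⟩) * x k - (x ⟨ij.1, hi⟩ - x ⟨ij.2, hj⟩) * y k) ∈
      E.map (polyBE 6) := List.mem_map.2 ⟨_, hmem, rfl⟩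
  have hkey : key5 (fun k => (y ⟨ij.1, hi⟩ - y ⟨ij.2, hj⟩) * x k - (x ⟨ij.1, hi⟩ - x ⟨ij.2, hj⟩) * y k) =
      cv5 p (mVal p (vals x) (vals y) ij.1 ij.2 0) (mVal p (vals x) (vals y) ij.1 ij.2 1)
        (mVal p (vals x) (vals y) ij.1 ij.2 2) (mVal p (vals x) (vals y) ij.1 ij.2 3)
        (mVal p (vals x) (vals y) ij.1 ij.2 4) := by
    unfold key5
    rw [val_m_eq_mVal x y ⟨ij.1, hi⟩ ⟨ij.2, hj⟩ 0, val_m_eq_mVal x y ⟨ij.1, hi⟩ ⟨ij.2, hj⟩ 1,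
      val_m_eq_mVal x y ⟨ij.1, hi⟩ ⟨ij.2, hj⟩ 2, val_m_eq_mVal x y ⟨ij.1, hi⟩ ⟨ij.2, hj⟩ 3,
      val_m_eq_mVal x y ⟨ij.1, hi⟩ ⟨ij.2, hj⟩ 4]
    rfl
  rw [hkey] at hcode
  rw [Bool.eq_false_iff, ne_eq, List.contains_iff_mem] at hnot
  exact hnot hcode

/-- **The `x`-arrangement of `x` is enumerated**: for `x 0 = x 1` and `key5 x = k`. [folklore] -/
theorem vals_mem_arrangements01 (x : Fin 5 → ZMod p) (hx : x 0 = x 1) {k : List ℕ} (hk : key5 x = k) :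
    vals x ∈ arrangements01 p k := by
  have g0 := one_le_getD_key5 x 0
  have g2 := one_le_getD_key5 x 2
  have g3 := one_le_getD_key5 x 3
  have g4 := one_le_getD_key5 x 4
  rw [hk] at g0 g2 g3 g4
  have hcv : (cv5 p (x 0).val (x 0).val (x 2).val (x 3).val (x 4).val == k) = true := by
    rw [beq_iff_eq, ← hk, key5, hx]
  have e : vals x = [(x 0).val, (x 0).val, (x 2).val, (x 3).val, (x 4).val] := by rw [vals, hx]
  rw [e, arrangements01, List.mem_flatMap]
  refine ⟨(x 0).val, List.mem_range.2 (ZMod.val_lt _), ?_⟩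
  rw [if_neg (by rw [beq_iff_eq]; omega), List.mem_flatMap]
  refine ⟨(x 2).val, List.mem_range.2 (ZMod.val_lt _), ?_⟩
  rw [if_neg (by rw [beq_iff_eq]; omega), List.mem_flatMap]
  refine ⟨(x 3).val, List.mem_range.2 (ZMod.val_lt _), ?_⟩
  rw [if_neg (by rw [beq_iff_eq]; omega), List.mem_flatMap]
  refine ⟨(x 4).val, List.mem_range.2 (ZMod.val_lt _), ?_⟩
  rw [if_neg (by rw [beq_iff_eq]; omega), if_pos hcv]
  exact List.mem_singleton.2 rfl

/-- **The `y`-arrangement of `y` is enumerated**: for `y 2 = y 3` and `key5 y = k`. [folklore] -/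
theorem vals_mem_arrangements23 (y : Fin 5 → ZMod p) (hy : y 2 = y 3) {k : List ℕ} (hk : key5 y = k) :
    vals y ∈ arrangements23 p k := by
  have g2 := one_le_getD_key5 y 2
  have g0 := one_le_getD_key5 y 0
  have g1 := one_le_getD_key5 y 1
  have g4 := one_le_getD_key5 y 4
  rw [hk] at g0 g1 g2 g4
  have hcv : (cv5 p (y 0).val (y 1).val (y 2).val (y 2).val (y 4).val == k) = true := by
    rw [beq_iff_eq, ← hk, key5, hy]
  have e : vals y = [(y 0).val, (y 1).val, (y 2).val, (y 2).val, (y 4).val] := by rw [vals, hy]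
  rw [e, arrangements23, List.mem_flatMap]
  refine ⟨(y 2).val, List.mem_range.2 (ZMod.val_lt _), ?_⟩
  rw [if_neg (by rw [beq_iff_eq]; omega), List.mem_flatMap]
  refine ⟨(y 0).val, List.mem_range.2 (ZMod.val_lt _), ?_⟩
  rw [if_neg (by rw [beq_iff_eq]; omega), List.mem_flatMap]
  refine ⟨(y 1).val, List.mem_range.2 (ZMod.val_lt _), ?_⟩
  rw [if_neg (by rw [beq_iff_eq]; omega), List.mem_flatMap]
  refine ⟨(y 4).val, List.mem_range.2 (ZMod.val_lt _), ?_⟩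
  rw [if_neg (by rw [beq_iff_eq]; omega), if_pos hcv]
  exact List.mem_singleton.2 rfl

/-- **Soundness of the pair check** (the hypothesis `h3` of `exists_goodP`). [folklore] -/
theorem h3_of_checkH3 (E R : List (List ℕ)) (hE2 : ∀ k ∈ E, ∀ κ : ℕ, 1 ≤ κ → κ < p → scaleVec p κ k ∈ E)
    (hR : ∀ k ∈ E, ∃ κ : ℕ, 1 ≤ κ ∧ κ < p ∧ scaleVec p κ k ∈ R)
    (hchk : checkH3 p (E.map (polyBE 6)) (allArr23 p R) R = true)
    (x y : Fin 5 → ZMod p) (hx : x 0 = x 1) (hxE : key5 x ∈ E) (hy : y 2 = y 3) (hyE : key5 y ∈ E)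
    (_hsep : ∀ i j : Fin 5, i ≠ j → (x i, y i) ≠ (x j, y j)) :
    ∃ i j : Fin 5, i ≠ j ∧ key5 (fun k => (y i - y j) * x k - (x i - x j) * y k) ∉ E := by
  -- scale `x` and `y` into representatives
  obtain ⟨κ, hκ1, hκp, hκR⟩ := hR _ hxE
  obtain ⟨μ, hμ1, hμp, hμR⟩ := hR _ hyE
  have hκ : ((κ : ℕ) : ZMod p) ≠ 0 := by
    rw [Ne, ZMod.natCast_eq_zero_iff]; exact Nat.not_dvd_of_pos_of_lt hκ1 hκp
  have hμ : ((μ : ℕ) : ZMod p) ≠ 0 := by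
    rw [Ne, ZMod.natCast_eq_zero_iff]; exact Nat.not_dvd_of_pos_of_lt hμ1 hμp
  set x' : Fin 5 → ZMod p := fun i => ((κ : ℕ) : ZMod p) * x i with hx'
  set y' : Fin 5 → ZMod p := fun i => ((μ : ℕ) : ZMod p) * y i with hy'
  have hxR : key5 x' ∈ R := by
    have := key5_smul hκ x
    rw [ZMod.val_natCast, Nat.mod_eq_of_lt hκp] at this
    rw [hx', this]; exact hκR
  have hyR : key5 y' ∈ R := by
    have := key5_smul hμ y
    rw [ZMod.val_natCast, Nat.mod_eq_of_lt hμp] at this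
    rw [hy', this]; exact hμR
  have hx01 : x' 0 = x' 1 := by simp only [hx', hx]
  have hy23 : y' 2 = y' 3 := by simp only [hy', hy]
  -- read the check at the arrangements of `x'` and `y'`
  rw [checkH3, List.all_eq_true] at hchk
  have h1 := hchk _ hxR
  rw [checkH3k, List.all_eq_true] at h1
  have h2 := h1 _ (vals_mem_arrangements01 x' hx01 rfl)
  rw [List.all_eq_true] at h2
  have hys : vals y' ∈ allArr23 p R := by
    rw [allArr23, List.mem_flatMap]
    exact ⟨_, hyR, vals_mem_arrangements23 y' hy23 rfl⟩
  have hpg := h2 _ hys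
  obtain ⟨i, j, hij, hm⟩ := exists_pair_of_pairGood x' y' hpg
  refine ⟨i, j, hij, fun hmem => hm ?_⟩
  have hsc : (fun k => (y' i - y' j) * x' k - (x' i - x' j) * y' k) =
      fun k => (((κ : ℕ) : ZMod p) * ((μ : ℕ) : ZMod p)) * ((y i - y j) * x k - (x i - x j) * y k) := by
    funext k; simp only [hx', hy']; ring
  rw [hsc]
  exact key5_smul_mem hE2 (mul_ne_zero hκ hμ) _ hmem

end Sound

end ZpZpDomino

end Summit.MatrixMultiplication.OmegaCensus
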